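import Mathlib
import Summits.Ventures.PercRepro2.Defs
import Summits.Ventures.PercRepro2.Independence
import Summits.Ventures.PercRepro2.Harris
import Summits.Ventures.PercRepro2.Graph
import Summits.Ventures.PercRepro2.Exploration
import Summits.Ventures.PercRepro2.Events
import Summits.Ventures.PercRepro2.FourFunctions
import Summits.Ventures.PercRepro2.Induced
import Summits.Ventures.PercRepro2.Frontier
import Summits.Ventures.PercRepro2.ObsIndependence
import Summits.Ventures.PercRepro2.BHK
import Summits.Ventures.PercRepro2.BHKEvents
import Summits.Ventures.PercRepro2.OrderPreservation

/-!
# Order preservation under decreasing events at the worse root (blind cell PercRepro2, typer-1;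
row R10d)

PRIOR ART (lead's re-read of KN24 = Kozma–Nitzan, arXiv:2401.12397, p. 6, logged 2026-08-22T17:00Z):
the connection case `orderPreserving_conn_down` is KN24 **Lemma 3 (ii)** in the limit `δ ↓ 0`
("if `Q` is a decreasing event in the cluster of `a₁` then `P(a₁ ↔ b, Q) < P(a₂ ↔ b, Q) + δ`"),
proved there by the same cancellation + BHK argument; the cluster-property form
`orderPreserving_cluster_down` (an arbitrary up-set `𝓥` in place of `{b ∈ ·}`) and the joint form
R10fd (p1) are the cell's own generalisations.

For vertices `o` (the better root) and `a` (the worse root), an up-set `𝓥` with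
`P(C(a) ∈ 𝓥) ≤ P(C(o) ∈ 𝓥)` (e.g. `𝓥 = {W | b ∈ W}`: `P(a ↔ b) ≤ P(o ↔ b)`) and a DOWN-set `𝓓`
(a decreasing event `{C(a) ∈ 𝓓}` determined by the cluster of the worse root):

  `P(C(a) ∈ 𝓥, C(a) ∈ 𝓓) ≤ P(C(o) ∈ 𝓥, C(a) ∈ 𝓓)`   (`orderPreserving_cluster_down`).

Proof (`proofs/LEAD-PROOFSHAPES.md` §8.9 ADDENDUM 3): the skeleton of p1's
`orderPreserving_cluster` with the two BHK inequalities complemented — split along `{o ↔ a}`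
(there the clusters coincide), and on `D = {o ↮ a}` chain
(1) the cross-cluster inequality for the up-sets `𝓥` at `o` and `𝓓ᶜ` at `a`, complemented;
(2) the reduced hypothesis times `P(C(a) ∈ 𝓓, D)`;
(3) the same-cluster inequality at root `a` for `𝓥`, `𝓓ᶜ`, complemented.
The connection case `orderPreserving_conn_down` is `𝓥 = {W | b ∈ W}`.
-/

namespace Summit.Ventures.PercRepro2

section OrderPreservationDual

variable {V : Type*} {E : Type*} [Fintype E] [DecidableEq E] [Fintype V] [DecidableEq V]
  {R : Type*} [CommRing R] [LinearOrder R] [IsStrictOrderedRing R]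

omit [Fintype E] [DecidableEq E] [Fintype V] [DecidableEq V] in
/-- `{C(x) ∈ 𝓓ᶜ}` is the complement of `{C(x) ∈ 𝓓}`. -/
lemma clusterInEvent_compl (ends : E → Sym2 V) (x : V) (𝓓 : Set (Set V)) :
    clusterInEvent ends x 𝓓ᶜ = (clusterInEvent ends x 𝓓)ᶜ := by
  ext ω
  simp

/-- **R10d — order preservation under decreasing events at the worse root**: for an up-set `𝓥`
and a down-set `𝓓`, `P(C(a) ∈ 𝓥) ≤ P(C(o) ∈ 𝓥)` implies
`P(C(a) ∈ 𝓥, C(a) ∈ 𝓓) ≤ P(C(o) ∈ 𝓥, C(a) ∈ 𝓓)`.  The cluster-property form (general up-set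
`𝓥`) is the cell's generalisation of KN24 Lemma 3 (ii) (which is the case `𝓥 = {W | b ∈ W}`,
`orderPreserving_conn_down`). -/
theorem orderPreserving_cluster_down (p : E → R) (hp : IsProbVec p) (ends : E → Sym2 V)
    (o a : V) {𝓥 𝓓 : Set (Set V)} (h𝓥 : IsUpperSet 𝓥) (h𝓓 : IsLowerSet 𝓓)
    (h : prob p (clusterInEvent ends a 𝓥) ≤ prob p (clusterInEvent ends o 𝓥)) :
    prob p (clusterInEvent ends a 𝓥 ∩ clusterInEvent ends a 𝓓) ≤
      prob p (clusterInEvent ends o 𝓥 ∩ clusterInEvent ends a 𝓓) := by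
  set D := (connEvent ends o a)ᶜ with hD
  -- split the hypothesis and the claim along `{o ↔ a}` / `D`
  have s1 := prob_inter_add_prob_inter_compl p (clusterInEvent ends a 𝓥) (connEvent ends o a)
  have s2 := prob_inter_add_prob_inter_compl p (clusterInEvent ends o 𝓥) (connEvent ends o a)
  have s3 := prob_inter_add_prob_inter_compl p
    (clusterInEvent ends a 𝓥 ∩ clusterInEvent ends a 𝓓) (connEvent ends o a)
  have s4 := prob_inter_add_prob_inter_compl p
    (clusterInEvent ends o 𝓥 ∩ clusterInEvent ends a 𝓓) (connEvent ends o a)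
  -- on `{o ↔ a}` the clusters coincide
  have c1 : clusterInEvent ends a 𝓥 ∩ connEvent ends o a =
      clusterInEvent ends o 𝓥 ∩ connEvent ends o a := by
    have := clusterInEvent_inter_connEvent_eq ends o a 𝓥 Set.univ
    simpa only [Set.inter_univ] using this
  have c2 : clusterInEvent ends a 𝓥 ∩ clusterInEvent ends a 𝓓 ∩ connEvent ends o a =
      clusterInEvent ends o 𝓥 ∩ clusterInEvent ends a 𝓓 ∩ connEvent ends o a :=
    clusterInEvent_inter_connEvent_eq ends o a 𝓥 _
  rw [c1] at s1
  rw [c2] at s3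
  have hD' : prob p (clusterInEvent ends a 𝓥 ∩ D) ≤ prob p (clusterInEvent ends o 𝓥 ∩ D) := by
    linarith
  suffices hmain : prob p (clusterInEvent ends a 𝓥 ∩ clusterInEvent ends a 𝓓 ∩ D) ≤
      prob p (clusterInEvent ends o 𝓥 ∩ clusterInEvent ends a 𝓓 ∩ D) by linarith
  -- the complement splits on `D`
  have e1 := prob_inter_add_prob_inter_compl p (clusterInEvent ends o 𝓥 ∩ D)
    (clusterInEvent ends a 𝓓)
  have e2 := prob_inter_add_prob_inter_compl p D (clusterInEvent ends a 𝓓)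
  have e3 := prob_inter_add_prob_inter_compl p (clusterInEvent ends a 𝓥 ∩ D)
    (clusterInEvent ends a 𝓓)
  rw [Set.inter_right_comm, Set.inter_right_comm _ D, ← clusterInEvent_compl] at e1 e3
  rw [Set.inter_comm D, Set.inter_comm D, ← clusterInEvent_compl] at e2
  -- the two BHK inequalities, for the up-sets `𝓥` and `𝓓ᶜ`
  have hcross := bhk_cross_cluster p hp ends o a h𝓥 h𝓓.compl
  have hsame := bhk_same_cluster_events p hp ends a o h𝓥 h𝓓.compl
  rw [connEvent_comm ends a o] at hsame
  have hmid : prob p (clusterInEvent ends a 𝓥 ∩ D) * prob p (clusterInEvent ends a 𝓓 ∩ D) ≤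
      prob p (clusterInEvent ends o 𝓥 ∩ D) * prob p (clusterInEvent ends a 𝓓 ∩ D) :=
    mul_le_mul_of_nonneg_right hD' (prob_nonneg hp _)
  -- the products of the splits
  have e1' : prob p (clusterInEvent ends o 𝓥 ∩ clusterInEvent ends a 𝓓 ∩ D) * prob p D +
      prob p (clusterInEvent ends o 𝓥 ∩ clusterInEvent ends a 𝓓ᶜ ∩ D) * prob p D =
      prob p (clusterInEvent ends o 𝓥 ∩ D) * prob p D := by
    rw [← add_mul, e1]
  have e3' : prob p (clusterInEvent ends a 𝓥 ∩ clusterInEvent ends a 𝓓 ∩ D) * prob p D +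
      prob p (clusterInEvent ends a 𝓥 ∩ clusterInEvent ends a 𝓓ᶜ ∩ D) * prob p D =
      prob p (clusterInEvent ends a 𝓥 ∩ D) * prob p D := by
    rw [← add_mul, e3]
  have e2a : prob p (clusterInEvent ends a 𝓥 ∩ D) * prob p (clusterInEvent ends a 𝓓 ∩ D) +
      prob p (clusterInEvent ends a 𝓥 ∩ D) * prob p (clusterInEvent ends a 𝓓ᶜ ∩ D) =
      prob p (clusterInEvent ends a 𝓥 ∩ D) * prob p D := by
    rw [← mul_add, e2]
  have e2b : prob p (clusterInEvent ends o 𝓥 ∩ D) * prob p (clusterInEvent ends a 𝓓 ∩ D) +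
      prob p (clusterInEvent ends o 𝓥 ∩ D) * prob p (clusterInEvent ends a 𝓓ᶜ ∩ D) =
      prob p (clusterInEvent ends o 𝓥 ∩ D) * prob p D := by
    rw [← mul_add, e2]
  refine le_of_mul_le_mul_of_le (prob_mono hp Set.inter_subset_right) (prob_nonneg hp _)
    (prob_nonneg hp _) (prob_nonneg hp _) ?_
  linarith

/-- **R10d, connection case = KN24 Lemma 3 (ii)** (Kozma–Nitzan, arXiv:2401.12397, p. 6, with
`δ ↓ 0`; KNOWN, not a discovery of the cell): for a down-set `𝓓` (a decreasing event
`{C(a) ∈ 𝓓}` of the worse root), `P(a ↔ b) ≤ P(o ↔ b)` implies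
`P(a ↔ b, C(a) ∈ 𝓓) ≤ P(o ↔ b, C(a) ∈ 𝓓)`. -/
theorem orderPreserving_conn_down (p : E → R) (hp : IsProbVec p) (ends : E → Sym2 V) (o a b : V)
    {𝓓 : Set (Set V)} (h𝓓 : IsLowerSet 𝓓)
    (h : prob p (connEvent ends a b) ≤ prob p (connEvent ends o b)) :
    prob p (connEvent ends a b ∩ clusterInEvent ends a 𝓓) ≤
      prob p (connEvent ends o b ∩ clusterInEvent ends a 𝓓) := by
  rw [connEvent_eq_clusterInEvent ends a b, connEvent_eq_clusterInEvent ends o b] at h ⊢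
  exact orderPreserving_cluster_down p hp ends o a (isUpperSet_mem_setOf b) h𝓓 h

omit [Fintype E] [DecidableEq E] [Fintype V] [DecidableEq V] in
/-- `{a ↮ y}` is the cluster event of the down-set `{W | y ∉ W}`. -/
lemma compl_connEvent_eq_clusterInEvent (ends : E → Sym2 V) (a y : V) :
    (connEvent ends a y)ᶜ = clusterInEvent ends a {W | y ∉ W} := by
  ext ω
  simp [clusterInEvent]

omit [Fintype E] [DecidableEq E] [Fintype V] [DecidableEq V] in
/-- `{W | y ∉ W}` is a down-set. -/
lemma isLowerSet_notMem_setOf (y : V) : IsLowerSet {W : Set V | y ∉ W} :=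
  fun _ _ h hy hy' => hy (h hy')

/-- **Conditioned order** (corollary (i) of §8.9 ADDENDUM 3): `P(a ↔ b) ≤ P(o ↔ b)` implies
`P(a ↔ b, a ↮ y) ≤ P(o ↔ b, a ↮ y)`. -/
theorem orderPreserving_conn_avoid (p : E → R) (hp : IsProbVec p) (ends : E → Sym2 V)
    (o a b y : V) (h : prob p (connEvent ends a b) ≤ prob p (connEvent ends o b)) :
    prob p (connEvent ends a b ∩ (connEvent ends a y)ᶜ) ≤
      prob p (connEvent ends o b ∩ (connEvent ends a y)ᶜ) := by
  rw [compl_connEvent_eq_clusterInEvent]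
  exact orderPreserving_conn_down p hp ends o a b (isLowerSet_notMem_setOf y) h

omit [Fintype E] [DecidableEq E] [Fintype V] [DecidableEq V] in
/-- On `{x ↔ y}`, `{x ↔ b}` and `{y ↔ b}` coincide (with a further factor `A`). -/
lemma connEvent_inter_inter_connEvent_eq (ends : E → Sym2 V) (x y b : V) (A : Set (Config E)) :
    connEvent ends x b ∩ A ∩ connEvent ends x y = connEvent ends y b ∩ A ∩ connEvent ends x y := by
  ext ω
  simp only [Set.mem_inter_iff, mem_connEvent]
  exact ⟨fun ⟨⟨h1, h2⟩, h3⟩ => ⟨⟨conn_trans (conn_symm h3) h1, h2⟩, h3⟩,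
    fun ⟨⟨h1, h2⟩, h3⟩ => ⟨⟨conn_trans h3 h1, h2⟩, h3⟩⟩

/-- **Conditioned order, cancelled form** (§8.9 ADDENDUM 2): `P(a ↔ b) ≤ P(o ↔ b)` implies
`P(a ↔ b, a ↮ o, a ↮ y) ≤ P(o ↔ b, a ↮ o, a ↮ y)`. -/
theorem orderPreserving_conn_avoid_two (p : E → R) (hp : IsProbVec p) (ends : E → Sym2 V)
    (o a b y : V) (h : prob p (connEvent ends a b) ≤ prob p (connEvent ends o b)) :
    prob p (connEvent ends a b ∩ (connEvent ends a o)ᶜ ∩ (connEvent ends a y)ᶜ) ≤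
      prob p (connEvent ends o b ∩ (connEvent ends a o)ᶜ ∩ (connEvent ends a y)ᶜ) := by
  have h1 := orderPreserving_conn_avoid p hp ends o a b y h
  have s1 := prob_inter_add_prob_inter_compl p (connEvent ends a b ∩ (connEvent ends a y)ᶜ)
    (connEvent ends a o)
  have s2 := prob_inter_add_prob_inter_compl p (connEvent ends o b ∩ (connEvent ends a y)ᶜ)
    (connEvent ends a o)
  rw [connEvent_inter_inter_connEvent_eq ends a o b] at s1
  rw [Set.inter_right_comm, Set.inter_right_comm (connEvent ends o b)]
  linarith

/-- **G′-ORDER** (§8.9 ADDENDUM 2, the merged-graph order hypothesis of the R2′(3) reduction):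
with `Ũ = C(a₂) ∪ C(a₃)`, `P(a* ↔ b) ≤ P(a₂ ↔ b)` implies
`P(a* ↔ b, a* ∉ Ũ) ≤ P(b ∈ Ũ, a* ∉ Ũ)`. -/
theorem gprime_order (p : E → R) (hp : IsProbVec p) (ends : E → Sym2 V) (astar a₂ a₃ b : V)
    (h : prob p (connEvent ends astar b) ≤ prob p (connEvent ends a₂ b)) :
    prob p (connEvent ends astar b ∩ (connEvent ends astar a₂)ᶜ ∩ (connEvent ends astar a₃)ᶜ) ≤
      prob p ((connEvent ends a₂ b ∪ connEvent ends a₃ b) ∩ (connEvent ends astar a₂)ᶜ ∩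
        (connEvent ends astar a₃)ᶜ) :=
  (orderPreserving_conn_avoid_two p hp ends a₂ astar b a₃ h).trans
    (prob_mono hp (Set.inter_subset_inter_left _ (Set.inter_subset_inter_left _
      Set.subset_union_left)))

end OrderPreservationDual

end Summit.Ventures.PercRepro2
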